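import Summits.QuantumFields.YangMills.Theorems.LuscherReductionDressedRitzPolyakovLiftBasisGenericL
import Summits.QuantumFields.YangMills.Theorems.LuscherReductionDressedRitzPolyakovLiftTransplantRootR
import HarnessLib

/-!
# Route `LuscherReduction`, item `DressedRitz` (stmt-QuantumFields-20205), line «polyakovlift» r7, stub S-PSCAL″ — the QUANTIFIER SHELL of
# `PScalingExistsForL (TransplantBasisLR k)` (F9 layer D5-prep; fleet seat ym-20205-polyakovlift-s1 gen 3, on the LEAD's ask 2026-08-27T20:16Z)

Support module (`--supports stmt-QuantumFields-20205`, helper, no closure claim).  The registered r7 stub (skeleton sha16 b06d67d4467729f8) reads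
`Stmt.stub_pscaling := ∀ k, PScalingExistsForL (TransplantBasisLR k)`:
`∃ C lam0, ∀ lam ≤ lam0, ∃ L0, ∀ L ≥ L0, ∀ Λ ∈ [lam, 2lam], ∀ e₀ raw vacuum at B = 2L³/Λ³, ∃ g, TransplantBasisLR k L Λ g ∧ (o0′)(o5′)(o6′)` for the one-site shadow
family `w_i = K_B^[L](ins e₀ (g_i ∘ powLink L))`.  This file fixes, once and for all, the WITNESSES and the PARAMETER BOOKKEEPING of that text so that the analytic
core (LEAD's layers D2–D4: `PScal.dressed_clauses_of_concentration`, window/level packages, transfer, vacuum package) is ONE pointwise hypothesis `hcore` with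
every side fact handed in:

* basis witness `g_i := transplantObsL L Λ R f i` for a FIXED AL1 eigenfamily `f` with `f_0 > 0` (caller's choice, e.g. the restriction of a family reaching a
  cluster end) and the r7 radius `R := √√(1/Λ) = Λ^{−1/4}` (`rootRadius`: `R⁴Λ = 1`, `1 ≤ R` for `Λ ≤ 1`, `RΛ ≤ 1/4` for `Λ ≤ 1/8`);
* thresholds: a `Λ`-smallness `Λ ≤ Λ₁` (caller's `Λ₁ > 0`, may depend on `k, f`: tails `A e^{−R} ≤ 1/2`, …) and an `L`-largeness `L₁ lam ≤ L` (caller's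
  `L₁ : ℝ → ℕ`: `B ≥ B₁`, `x = Λ/L ≤ x₀`, …); the shell takes `lam0 := min (Λ₁/2) (1/16)` (so `Λ ≤ 2lam ≤ Λ₁` and `Λ ≤ 1/8`) and `L0 := max (L₁ lam) 1`;
* handed-in facts: `0 < lam ≤ Λ ≤ 2lam`, `Λ ≤ Λ₁`, `Λ ≤ 1/8`, `L₁ lam ≤ L`, `1 ≤ L`, `B = 2L³/Λ³ > 0`, `bareLambda B = Λ/L`, `B·(Λ/(2L))³ = 1/4` (`μ = Λ/(2L)`),
  `1 ≤ R`, `R⁴Λ = 1`, `RΛ ≤ 1/4`, and the raw vacuum.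

★★ `pscalingExistsForL_transplantLR_of_core` — from such an `hcore` to `PScalingExistsForL (TransplantBasisLR k)` (membership by `TransplantBasisLR`'s definition).

HONEST FRAMING: quantifier plumbing at fixed lattice on the conditional femto rung R2b1; the analytic content of S-PSCAL″ is the hypothesis `hcore` (LEAD's D2–D4);
nothing here bears on infinite volume, the continuum limit or the Clay gap.  References: M. Lüscher, NPB 219 (1983) 233 [cite: Luscher1983, §3].
-/

set_option autoImplicit false

noncomputable section

open MeasureTheory Filter Topology Real
open Literature.MathematicalPhysics.QuantumFieldTheory (GaugeConfig Site gaugeTransform)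
open Literature.Analysis.OperatorTheory.YMMatrixModel
open scoped BigOperators

namespace Summit.QuantumFields.YangMills.Theorems.FemtoTransferGap.PolyakovLift

open Summit.QuantumFields.YangMills.Theorems.FemtoTransferGap

/-! ## §1 The r7 radius `R = √√(1/Λ)` and the scaled coupling `B = 2L³/Λ³` -/

/-- `(√√(1/Λ))⁴ = 1/Λ` for `Λ > 0`. [cite: Luscher1983, §3] -/
theorem rootRadius_pow_four {Λ : ℝ} (hΛ : 0 < Λ) : Real.sqrt (Real.sqrt (1 / Λ)) ^ 4 = 1 / Λ := by
  rw [show (4 : ℕ) = 2 * 2 from rfl, pow_mul, Real.sq_sqrt (Real.sqrt_nonneg _), Real.sq_sqrt (by positivity)]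

/-- `(√√(1/Λ))⁴ · Λ = 1` for `Λ > 0` (the r7 floor `1 ≤ R⁴Λ` with equality). [cite: Luscher1983, §3] -/
theorem rootRadius_pow_four_mul {Λ : ℝ} (hΛ : 0 < Λ) : Real.sqrt (Real.sqrt (1 / Λ)) ^ 4 * Λ = 1 := by
  rw [rootRadius_pow_four hΛ]; field_simp

/-- `1 ≤ √√(1/Λ)` for `0 < Λ ≤ 1`. [cite: Luscher1983, §3] -/
theorem one_le_rootRadius {Λ : ℝ} (hΛ : 0 < Λ) (hΛ1 : Λ ≤ 1) : 1 ≤ Real.sqrt (Real.sqrt (1 / Λ)) := by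
  rw [Real.le_sqrt zero_le_one (Real.sqrt_nonneg _), one_pow, Real.le_sqrt zero_le_one (by positivity), one_pow,
    le_div_iff₀ hΛ]
  linarith

/-- `√√(1/Λ) · Λ ≤ 1/4` for `0 < Λ ≤ 1/8` (`(RΛ)⁴ = Λ³ ≤ 1/512 < (1/4)⁴`). [cite: Luscher1983, §3] -/
theorem rootRadius_mul_le {Λ : ℝ} (hΛ : 0 < Λ) (hΛ8 : Λ ≤ 1 / 8) : Real.sqrt (Real.sqrt (1 / Λ)) * Λ ≤ 1 / 4 := by
  have hx0 : 0 ≤ Real.sqrt (Real.sqrt (1 / Λ)) * Λ := mul_nonneg (Real.sqrt_nonneg _) hΛ.le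
  have hx4 : (Real.sqrt (Real.sqrt (1 / Λ)) * Λ) ^ 4 ≤ (1 / 4 : ℝ) ^ 4 := by
    have e : (Real.sqrt (Real.sqrt (1 / Λ)) * Λ) ^ 4 = Λ ^ 3 := by
      rw [mul_pow, rootRadius_pow_four hΛ]; field_simp
    rw [e]
    calc Λ ^ 3 ≤ (1 / 8 : ℝ) ^ 3 := pow_le_pow_left₀ hΛ.le hΛ8 3
      _ ≤ (1 / 4 : ℝ) ^ 4 := by norm_num
  exact le_of_pow_le_pow_left₀ (by norm_num) (by norm_num) hx4

/-- `B = 2L³/Λ³ > 0`. [cite: Luscher1983, §3] -/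
theorem scaledCoupling_pos {Λ : ℝ} (hΛ : 0 < Λ) {L : ℕ} (hL : 1 ≤ L) : 0 < 2 * (L : ℝ) ^ 3 / Λ ^ 3 := by
  have hLr : (0 : ℝ) < L := by exact_mod_cast hL
  positivity

/-- `B · μ³ = 1/4` for `B = 2L³/Λ³`, `μ = Λ/(2L)`. [cite: Luscher1983, §3] -/
theorem scaledCoupling_mul_mu_cube {Λ : ℝ} (hΛ : 0 < Λ) {L : ℕ} (hL : 1 ≤ L) :
    2 * (L : ℝ) ^ 3 / Λ ^ 3 * (Λ / (2 * L)) ^ 3 = 1 / 4 := by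
  have hLr : (0 : ℝ) < L := by exact_mod_cast hL
  field_simp
  ring

/-- `bareLambda (2L³/Λ³) = Λ/L` (`λ_b = (2/B)^{1/3}`). [cite: Luscher1983, §3] -/
theorem bareLambda_scaledCoupling {Λ : ℝ} (hΛ : 0 < Λ) {L : ℕ} (hL : 1 ≤ L) :
    bareLambda (2 * (L : ℝ) ^ 3 / Λ ^ 3) = Λ / L := by
  have hLr : (0 : ℝ) < L := by exact_mod_cast hL
  unfold bareLambda
  have hq : 2 / (2 * (L : ℝ) ^ 3 / Λ ^ 3) = (Λ / L) ^ 3 := by field_simp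
  rw [hq, show ((1 : ℝ) / 3) = ((3 : ℕ) : ℝ)⁻¹ by norm_num]
  exact Real.pow_rpow_inv_natCast (div_nonneg hΛ.le hLr.le) (by norm_num)

/-! ## §2 The shell -/

/-- ★★ **The quantifier shell of `PScalingExistsForL (TransplantBasisLR k)`.**  Fix an AL1 eigenfamily `f` with `f_0 > 0`, a constant `C ≥ 0`, a `Λ`-threshold
`Λ₁ > 0` and an `L`-threshold `L₁ : ℝ → ℕ`.  Suppose the analytic core holds POINTWISE: for all `lam, Λ, L, e₀` with `0 < lam ≤ Λ ≤ 2lam`, `Λ ≤ Λ₁`, `Λ ≤ 1/8`,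
`L₁ lam ≤ L`, `1 ≤ L`, and — handed in — `B = 2L³/Λ³ > 0`, `bareLambda B = Λ/L`, `B(Λ/(2L))³ = 1/4`, `R = √√(1/Λ)` with `1 ≤ R`, `R⁴Λ = 1`, `RΛ ≤ 1/4`, and
`e₀` a raw vacuum at `B`, the clauses (o0′)(o5′)(o6′) of `PScalingExistsForL` hold with constant `C` for the shadow family of `g_i := transplantObsL L Λ R f i`.
Then `PScalingExistsForL (TransplantBasisLR k)` (with `lam0 = min (Λ₁/2) (1/16)`, `L0 = max (L₁ lam) 1`). [cite: Luscher1983, §3] -/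
theorem pscalingExistsForL_transplantLR_of_core (k : ℕ) (f : Fin (k + 1) → ZM → ℝ) (hf : IsEigenFamily k f) (hpos : ∀ x, 0 < f 0 x)
    {C Λ₁ : ℝ} (hC : 0 ≤ C) (hΛ₁ : 0 < Λ₁) (L₁ : ℝ → ℕ)
    (hcore : ∀ (lam Λ : ℝ) (L : ℕ) (e₀ : GaugeConfig 3 1 SU2 → ℝ) (B R : ℝ),
      0 < lam → lam ≤ Λ → Λ ≤ 2 * lam → Λ ≤ Λ₁ → Λ ≤ 1 / 8 → L₁ lam ≤ L → 1 ≤ L →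
      B = 2 * (L : ℝ) ^ 3 / Λ ^ 3 → R = Real.sqrt (Real.sqrt (1 / Λ)) →
      0 < B → bareLambda B = Λ / L → B * (Λ / (2 * L)) ^ 3 = 1 / 4 →
      1 ≤ R → R ^ 4 * Λ = 1 → R * Λ ≤ 1 / 4 →
      IsRawVacuum (L := 1) B e₀ →
      let g : Fin k → (GaugeConfig 3 1 SU2 → ℝ) := fun i => transplantObsL L Λ R f i
      let w : Fin k → (GaugeConfig 3 1 SU2 → ℝ) := shadowFamily B L e₀ g
      let m0 := levelValue su2Rep 1 B 0
      (∀ i : Fin k, 0 < l2 (w i) (w i)) ∧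
      (∀ i : Fin k,
        l2 (w i) (transferApply B (w i)) * m0 ≤ Real.exp (C * Λ ^ 2 / L) * (levelValue su2Rep 1 B ((i : ℕ) + 1) * m0) * l2 (w i) (w i) ∧
        levelValue su2Rep 1 B ((i : ℕ) + 1) * m0 * l2 (w i) (w i) ≤ Real.exp (C * Λ ^ 2 / L) * (l2 (w i) (transferApply B (w i)) * m0)) ∧
      (∀ i l : Fin k, i ≠ l →
        |l2 (w i) (transferApply B (w l)) -
            (l2 (w i) (transferApply B (w i)) / l2 (w i) (w i) + l2 (w l) (transferApply B (w l)) / l2 (w l) (w l)) / 2 *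
              l2 (w i) (w l)|
          ≤ C * (Λ ^ 2 / L) * m0 * (Real.sqrt (l2 (w i) (w i)) * Real.sqrt (l2 (w l) (w l))))) :
    PScalingExistsForL (TransplantBasisLR k) := by
  refine ⟨C, min (Λ₁ / 2) (1 / 16), hC, lt_min (by positivity) (by norm_num), fun lam hlam hle => ?_⟩
  refine ⟨max (L₁ lam) 1, fun L hL Λ h1 h2 e₀ he₀ => ?_⟩
  have hΛ : 0 < Λ := lt_of_lt_of_le hlam h1
  have hΛ₁' : Λ ≤ Λ₁ := by
    have := hle.trans (min_le_left _ _)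
    linarith
  have hΛ8 : Λ ≤ 1 / 8 := by
    have := hle.trans (min_le_right _ _)
    linarith
  have hL1 : 1 ≤ L := le_trans (le_max_right _ _) hL
  have hL₁ : L₁ lam ≤ L := le_trans (le_max_left _ _) hL
  have hR1 : 1 ≤ Real.sqrt (Real.sqrt (1 / Λ)) := one_le_rootRadius hΛ (by linarith)
  have hR4 : Real.sqrt (Real.sqrt (1 / Λ)) ^ 4 * Λ = 1 := rootRadius_pow_four_mul hΛ
  have hRΛ : Real.sqrt (Real.sqrt (1 / Λ)) * Λ ≤ 1 / 4 := rootRadius_mul_le hΛ hΛ8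
  refine ⟨fun i => transplantObsL L Λ (Real.sqrt (Real.sqrt (1 / Λ))) f i,
    ⟨f, Real.sqrt (Real.sqrt (1 / Λ)), hf, hpos, hR1, le_of_eq hR4.symm, hRΛ, fun _ => rfl⟩, ?_⟩
  exact hcore lam Λ L e₀ (2 * (L : ℝ) ^ 3 / Λ ^ 3) (Real.sqrt (Real.sqrt (1 / Λ))) hlam h1 h2 hΛ₁' hΛ8 hL₁ hL1 rfl rfl
    (scaledCoupling_pos hΛ hL1) (bareLambda_scaledCoupling hΛ hL1) (scaledCoupling_mul_mu_cube hΛ hL1) hR1 hR4 hRΛ he₀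


/-! ## §3 The primed shell: the consumers' side facts handed in as well

The F9 inputs read fixed side hypotheses: the one-site quasimode package (`TransplantForms.oneSite_package`, seat infvol-p2) wants `0 < B`, `0 < μ`, `Bμ³ = 1/4`,
`μ ≤ 1/8`, `π ≤ B`, `1 ≤ R'`, `R' ≤ 1/(8μ)` at `μ = Λ/(2L)` for both radii `R' ∈ {R, R_v}`; the main-term identity (`shadowObs_mul_ground_ae_of_radius`, seat w1a)
wants `0 < Λ`, `0 < R`, `√2·R ≤ R_v`, `√2·R_v·Λ < π`, `0 < L`.  With the LEAD's vacuum radius `R_v := 11/(5Λ)` all of these are parameter arithmetic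
(`√2·11/5 < 3.14 < π`; `R_v ≤ L/(4Λ)` needs `L ≥ 9`), so the primed shell hands them in and takes `L0 := max (L₁ lam) 9`. -/

/-- `√2 ≤ 3/2` (local copy; the tree has it under `Literature.Analysis.FluidPDE.Tao2016.sqrt_two_le`). [folklore] -/
private theorem sqrt_two_le_three_halves : Real.sqrt 2 ≤ 3 / 2 := by
  rw [Real.sqrt_le_left (by norm_num)]; norm_num

/-- `√2 · (11/5) < π` (`√2 < 99/70`, `11·99/350 < 3.14 < π`). [folklore] -/
private theorem sqrt_two_mul_lt_pi : Real.sqrt 2 * (11 / 5) < Real.pi := by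
  have h1 : Real.sqrt 2 < 99 / 70 := by
    rw [Real.sqrt_lt' (by norm_num)]; norm_num
  have h2 := Real.pi_gt_d2
  nlinarith

/-- ★★ **The primed quantifier shell**: as `pscalingExistsForL_transplantLR_of_core`, with the vacuum radius `R_v = 11/(5Λ)` and the side facts of the F9
consumers handed in too: `0 < Λ`, `0 < Λ/(2L) ≤ 1/8`, `π ≤ B`, `R ≤ 1/(8·(Λ/(2L)))`, `1 ≤ R_v`, `√2·R ≤ R_v`, `√2·R_v·Λ < π`, `R_v ≤ 1/(8·(Λ/(2L)))`
(`L0 := max (L₁ lam) 9`). [cite: Luscher1983, §3] -/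
theorem pscalingExistsForL_transplantLR_of_core' (k : ℕ) (f : Fin (k + 1) → ZM → ℝ) (hf : IsEigenFamily k f) (hpos : ∀ x, 0 < f 0 x)
    {C Λ₁ : ℝ} (hC : 0 ≤ C) (hΛ₁ : 0 < Λ₁) (L₁ : ℝ → ℕ)
    (hcore : ∀ (lam Λ : ℝ) (L : ℕ) (e₀ : GaugeConfig 3 1 SU2 → ℝ) (B R Rv : ℝ),
      0 < lam → lam ≤ Λ → Λ ≤ 2 * lam → 0 < Λ → Λ ≤ Λ₁ → Λ ≤ 1 / 8 → L₁ lam ≤ L → 9 ≤ L →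
      B = 2 * (L : ℝ) ^ 3 / Λ ^ 3 → R = Real.sqrt (Real.sqrt (1 / Λ)) → Rv = 11 / (5 * Λ) →
      0 < B → Real.pi ≤ B → bareLambda B = Λ / L → B * (Λ / (2 * L)) ^ 3 = 1 / 4 →
      0 < Λ / (2 * L) → Λ / (2 * L) ≤ 1 / 8 →
      1 ≤ R → R ^ 4 * Λ = 1 → R * Λ ≤ 1 / 4 → R ≤ 1 / (8 * (Λ / (2 * L))) →
      1 ≤ Rv → Real.sqrt 2 * R ≤ Rv → Real.sqrt 2 * Rv * Λ < Real.pi → Rv ≤ 1 / (8 * (Λ / (2 * L))) →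
      IsRawVacuum (L := 1) B e₀ →
      let g : Fin k → (GaugeConfig 3 1 SU2 → ℝ) := fun i => transplantObsL L Λ R f i
      let w : Fin k → (GaugeConfig 3 1 SU2 → ℝ) := shadowFamily B L e₀ g
      let m0 := levelValue su2Rep 1 B 0
      (∀ i : Fin k, 0 < l2 (w i) (w i)) ∧
      (∀ i : Fin k,
        l2 (w i) (transferApply B (w i)) * m0 ≤ Real.exp (C * Λ ^ 2 / L) * (levelValue su2Rep 1 B ((i : ℕ) + 1) * m0) * l2 (w i) (w i) ∧
        levelValue su2Rep 1 B ((i : ℕ) + 1) * m0 * l2 (w i) (w i) ≤ Real.exp (C * Λ ^ 2 / L) * (l2 (w i) (transferApply B (w i)) * m0)) ∧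
      (∀ i l : Fin k, i ≠ l →
        |l2 (w i) (transferApply B (w l)) -
            (l2 (w i) (transferApply B (w i)) / l2 (w i) (w i) + l2 (w l) (transferApply B (w l)) / l2 (w l) (w l)) / 2 *
              l2 (w i) (w l)|
          ≤ C * (Λ ^ 2 / L) * m0 * (Real.sqrt (l2 (w i) (w i)) * Real.sqrt (l2 (w l) (w l))))) :
    PScalingExistsForL (TransplantBasisLR k) := by
  refine pscalingExistsForL_transplantLR_of_core k f hf hpos hC hΛ₁ (fun lam => max (L₁ lam) 9) ?_
  intro lam Λ L e₀ B R hlam h1 h2 hΛ₁' hΛ8 hL hL1 hB hR hB0 hbare hBμ hR1 hR4 hRΛ he₀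
  have hΛ : 0 < Λ := lt_of_lt_of_le hlam h1
  have hL9 : 9 ≤ L := le_trans (le_max_right _ _) hL
  have hL₁ : L₁ lam ≤ L := le_trans (le_max_left _ _) hL
  have hLr : (9 : ℝ) ≤ L := by exact_mod_cast hL9
  have hμ0 : 0 < Λ / (2 * L) := by positivity
  have hμ8 : Λ / (2 * L) ≤ 1 / 8 := by
    rw [div_le_iff₀ (by positivity)]; nlinarith
  -- `π ≤ 4 ≤ 2·9³·8³ ≤ 2L³/Λ³`
  have hπB : Real.pi ≤ B := by
    rw [hB]
    have hΛ3 : Λ ^ 3 ≤ (1 / 8 : ℝ) ^ 3 := pow_le_pow_left₀ hΛ.le hΛ8 3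
    have hL3 : (9 : ℝ) ^ 3 ≤ (L : ℝ) ^ 3 := pow_le_pow_left₀ (by norm_num) hLr 3
    rw [le_div_iff₀ (pow_pos hΛ 3)]
    nlinarith [Real.pi_le_four, pow_pos hΛ 3]
  -- `R ≤ 1/(4Λ) ≤ L/(4Λ) = 1/(8μ)`
  have h8μ : 1 / (8 * (Λ / (2 * L))) = L / (4 * Λ) := by
    field_simp; ring
  have hR' : R ≤ 1 / (8 * (Λ / (2 * L))) := by
    rw [h8μ, le_div_iff₀ (by positivity)]
    have hR0 : 0 ≤ R := le_trans zero_le_one hR1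
    nlinarith
  set Rv : ℝ := 11 / (5 * Λ) with hRv
  have hRv1 : 1 ≤ Rv := by
    rw [hRv, le_div_iff₀ (by positivity)]; linarith
  have hRRv : Real.sqrt 2 * R ≤ Rv := by
    -- `√2·R ≤ (3/2)·(1/(4Λ)) ≤ 11/(5Λ)`
    have hR4Λ : R ≤ 1 / (4 * Λ) := by rw [le_div_iff₀ (by positivity)]; linarith
    have hR0 : 0 ≤ R := le_trans zero_le_one hR1
    calc Real.sqrt 2 * R ≤ (3 / 2) * (1 / (4 * Λ)) :=
          mul_le_mul sqrt_two_le_three_halves hR4Λ hR0 (by norm_num)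
      _ ≤ Rv := by
          have key : (3 : ℝ) / 2 * (1 / (4 * Λ)) = (3 / 8) / Λ := by field_simp; ring
          have key2 : (11 : ℝ) / (5 * Λ) = (11 / 5) / Λ := by field_simp
          rw [key, hRv, key2]
          exact div_le_div_of_nonneg_right (by norm_num) hΛ.le
  have hRvπ : Real.sqrt 2 * Rv * Λ < Real.pi := by
    have e : Real.sqrt 2 * Rv * Λ = Real.sqrt 2 * (11 / 5) := by rw [hRv]; field_simp
    rw [e]; exact sqrt_two_mul_lt_pi
  have hRv' : Rv ≤ 1 / (8 * (Λ / (2 * L))) := by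
    rw [h8μ, hRv, div_le_div_iff₀ (by positivity) (by positivity)]
    nlinarith
  exact hcore lam Λ L e₀ B R Rv hlam h1 h2 hΛ hΛ₁' hΛ8 hL₁ hL9 hB hR rfl hB0 hπB hbare hBμ hμ0 hμ8 hR1 hR4 hRΛ hR'
    hRv1 hRRv hRvπ hRv' he₀

end Summit.QuantumFields.YangMills.Theorems.FemtoTransferGap.PolyakovLift

end
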